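import Summits.PneNP.PneNP.Theorems.ExpanderLinearGeneratorsColumnTwoConn
import Summits.PneNP.PneNP.Theorems.ExpanderLinearGeneratorsExpansionForcesDepthFregeSize

/-!
# PneNP / ExpanderLinearGenerators — column weight two: closed components

Route `PneNP/ExpanderLinearGenerators`, support for crux stmt-PneNP-11443. A CLOSED COMPONENT of a
scope family of column weight `≤ 2` is a nonempty connected row set with empty boundary (every
point of its rows lies in two of its rows). This file proves:

* `nbr_ball_card_eq_empty` — balls saturate: the ball of radius `|V|` inside `V` has no neighbours;
* `rows_eq_pair` — a point lying in two distinct rows lies in no other row;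
* `exists_closed_subset` (with `Summit…exists_partner_of_boundary_eq_empty`) — every nonempty boundaryless row set contains a closed component;
* `closed_eq_of_inter_nonempty` — two closed components that meet are equal.

[folklore]
-/

namespace Summit.PneNP.PneNP.Theorems.ColumnTwo

open Finset Literature.Computability.MetaComplexity

variable {ι : Type*} [DecidableEq ι] {S : ι → Finset ℕ}

/-- Once a ball stops growing it is stationary. [folklore] -/
theorem ball_eq_of_nbr_eq_empty {V W : Finset ι} {t : ℕ} (h : nbr S V (ball S V W t) = ∅) :
    ∀ t', t ≤ t' → ball S V W t' = ball S V W t := by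
  intro t' ht'
  induction ht' with
  | refl => rfl
  | step _ ih => rw [ball_succ, ih, h, Finset.union_empty]

/-- **Saturation**: the ball of radius `|V|` around `W ⊆ V` inside `V` has no further neighbours.
[folklore] -/
theorem nbr_ball_card_eq_empty {V W : Finset ι} (hW : W ⊆ V) :
    nbr S V (ball S V W V.card) = ∅ := by
  by_contra hne
  -- then every earlier ball still grows, so the balls gain a row per step
  have hgrow : ∀ t ≤ V.card, t + W.card ≤ (ball S V W t).card := by
    intro t ht
    induction t with
    | zero => simp [ball_zero]
    | succ t ih =>
      have ih' := ih (by omega)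
      have hne' : (nbr S V (ball S V W t)).Nonempty := by
        rw [Finset.nonempty_iff_ne_empty]
        intro h
        exact hne (by rw [ball_eq_of_nbr_eq_empty h V.card (by omega), h])
      rw [card_ball_succ]
      have := Finset.card_pos.2 hne'
      omega
  have h1 := hgrow V.card le_rfl
  have h2 : (ball S V W V.card).card ≤ V.card := Finset.card_le_card (ball_subset hW _)
  rcases W.eq_empty_or_nonempty with rfl | hWne
  · -- the empty centre has empty balls
    have : ∀ t, ball S V (∅ : Finset ι) t = ∅ := by
      intro t
      induction t with
      | zero => rfl
      | succ t ih => rw [ball_succ, ih]; simp [nbr]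
    exact hne (by rw [this]; simp [nbr])
  · have := Finset.card_pos.2 hWne
    omega

section ColumnTwo

variable [Fintype ι] (hcw : ∀ v, coverDegree S Finset.univ v ≤ 2)
include hcw

/-- **A point in two distinct rows lies in no third row.** [folklore] -/
theorem rows_eq_pair {v : ℕ} {i j : ι} (hij : i ≠ j) (hi : v ∈ S i) (hj : v ∈ S j) {k : ι}
    (hk : v ∈ S k) : k = i ∨ k = j := by
  by_contra h
  push Not at h
  have hsub : ({i, j, k} : Finset ι) ⊆ Finset.univ.filter fun a => v ∈ S a := by
    intro a ha
    simp only [Finset.mem_insert, Finset.mem_singleton] at ha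
    rcases ha with rfl | rfl | rfl <;> simp [hi, hj, hk]
  have hcard : ({i, j, k} : Finset ι).card = 3 := by
    rw [Finset.card_insert_of_notMem (by simp [hij, h.1.symm]), Finset.card_pair h.2.symm]
  have h1 : (Finset.univ.filter fun a => v ∈ S a).card ≤ 2 := hcw v
  have h2 := Finset.card_le_card hsub
  omega

omit [Fintype ι] hcw in
/-- **Every nonempty boundaryless row set contains a closed component** (the saturated ball of one
of its rows). [folklore] -/
theorem exists_closed_subset {J : Finset ι} (hJne : J.Nonempty) (hJ : boundary S J = ∅) :
    ∃ K ⊆ J, K.Nonempty ∧ IsConn S K ∧ boundary S K = ∅ := by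
  obtain ⟨j, hj⟩ := hJne
  set K := ball S J {j} J.card with hK
  have hjJ : ({j} : Finset ι) ⊆ J := Finset.singleton_subset_iff.2 hj
  refine ⟨K, ball_subset hjJ _, ⟨j, subset_ball J {j} _ (Finset.mem_singleton_self j)⟩,
    isConn_ball (isConn_singleton j) _, ?_⟩
  rw [Finset.eq_empty_iff_forall_notMem]
  intro v hv
  obtain ⟨a, ⟨haK, hva⟩, huniq⟩ := existsUnique_of_mem_boundary hv
  obtain ⟨c, hcJ, hca, hvc⟩ := exists_partner_of_boundary_eq_empty hJ (ball_subset hjJ _ haK) hva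
  have hcK : c ∉ K := fun h => hca (huniq c ⟨h, hvc⟩)
  have hsat := nbr_ball_card_eq_empty (S := S) hjJ
  have : c ∈ nbr S J K := mem_nbr.2 ⟨hcJ, hcK, a, haK, v, Finset.mem_inter.2 ⟨hva, hvc⟩⟩
  rw [hK, hsat] at this
  exact Finset.notMem_empty _ this

/-- **Closed components that meet are equal.** [folklore] -/
theorem closed_eq_of_inter_nonempty {K K' : Finset ι} (hK : IsConn S K) (hKb : boundary S K = ∅)
    (hK' : IsConn S K') (hK'b : boundary S K' = ∅) (h : (K ∩ K').Nonempty) : K = K' := by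
  -- one inclusion, by connectivity of the first and closedness of the second
  have key : ∀ {K K' : Finset ι}, IsConn S K → boundary S K' = ∅ → (K ∩ K').Nonempty → K ⊆ K' := by
    intro K K' hK hK'b h
    by_contra hnot
    have hne : K ∩ K' ≠ K := fun heq => hnot fun x hx => (Finset.mem_inter.1 (heq.symm ▸ hx)).2
    obtain ⟨j, hjK, hjW, i, hi, v, hv⟩ := hK.step Finset.inter_subset_left h hne
    rw [Finset.mem_inter] at hi hv
    obtain ⟨c, hcK', hci, hvc⟩ := exists_partner_of_boundary_eq_empty hK'b hi.2 hv.1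
    have hij : i ≠ j := fun h' => hjW (h' ▸ Finset.mem_inter.2 hi)
    rcases rows_eq_pair hcw hij hv.1 hv.2 hvc with rfl | rfl
    · exact hci rfl
    · exact hjW (Finset.mem_inter.2 ⟨hjK, hcK'⟩)
  exact subset_antisymm (key hK hK'b h) (key hK' hKb (by rwa [Finset.inter_comm]))

end ColumnTwo

end Summit.PneNP.PneNP.Theorems.ColumnTwo

/-!
# PneNP / ExpanderLinearGenerators — column weight two: `T`-joins in connected row sets

Route `PneNP/ExpanderLinearGenerators`, support for crux stmt-PneNP-11443. In a scope family of
column weight `≤ 2`, for a connected row set `Kc` and two rows `u, w ∈ Kc` there is a set `J` of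
INNER points of `Kc` (points lying in two rows of `Kc`) meeting the row `u` and the row `w` an odd
number of times (when `u ≠ w`) and every other row an even number of times — the edge set of a walk
from `u` to `w`, recorded mod `2`. These joins replace walks in the routing argument
(`…ColumnTwoSigma`): their congestion is controlled by the set they live in.

* `card_inter_toggle` — toggling one point `v` changes `|S i ∩ J|` by one exactly when `v ∈ S i`;
* `exists_tjoin` — the `T`-join.

[folklore]
-/

namespace Summit.PneNP.PneNP.Theorems.ColumnTwo

open Finset Literature.Computability.MetaComplexity

variable {ι : Type*} [DecidableEq ι] {S : ι → Finset ℕ}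

/-- Toggling the point `v` in `J` changes the parity of `|S i ∩ J|` exactly when `v ∈ S i`.
[folklore] -/
theorem card_inter_toggle (A J : Finset ℕ) (v : ℕ) :
    Even ((A ∩ (if v ∈ J then J.erase v else insert v J)).card) ↔
      (Even ((A ∩ J).card) ↔ v ∉ A) := by
  by_cases hvJ : v ∈ J <;> by_cases hvA : v ∈ A
  · rw [if_pos hvJ]
    have h1 : A ∩ J = insert v (A ∩ J.erase v) := by
      ext x
      simp only [Finset.mem_inter, Finset.mem_insert, Finset.mem_erase]
      constructor
      · rintro ⟨hxA, hxJ⟩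
        by_cases hxv : x = v
        · exact Or.inl hxv
        · exact Or.inr ⟨hxA, hxv, hxJ⟩
      · rintro (rfl | ⟨hxA, -, hxJ⟩)
        · exact ⟨hvA, hvJ⟩
        · exact ⟨hxA, hxJ⟩
    have h2 : (A ∩ J).card = (A ∩ J.erase v).card + 1 := by
      rw [h1, Finset.card_insert_of_notMem (by simp)]
    rw [h2, Nat.even_add_one]
    tauto
  · rw [if_pos hvJ]
    have h1 : A ∩ J.erase v = A ∩ J := by
      ext x
      simp only [Finset.mem_inter, Finset.mem_erase]
      constructor
      · rintro ⟨hxA, -, hxJ⟩; exact ⟨hxA, hxJ⟩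
      · rintro ⟨hxA, hxJ⟩; exact ⟨hxA, fun h => hvA (h ▸ hxA), hxJ⟩
    rw [h1]
    tauto
  · rw [if_neg hvJ]
    have h1 : A ∩ insert v J = insert v (A ∩ J) := by
      ext x
      simp only [Finset.mem_inter, Finset.mem_insert]
      constructor
      · rintro ⟨hxA, rfl | hxJ⟩
        · exact Or.inl rfl
        · exact Or.inr ⟨hxA, hxJ⟩
      · rintro (rfl | ⟨hxA, hxJ⟩)
        · exact ⟨hvA, Or.inl rfl⟩
        · exact ⟨hxA, Or.inr hxJ⟩
    rw [h1, Finset.card_insert_of_notMem (fun h => hvJ (Finset.mem_inter.1 h).2), Nat.even_add_one]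
    tauto
  · rw [if_neg hvJ]
    have h1 : A ∩ insert v J = A ∩ J := by
      ext x
      simp only [Finset.mem_inter, Finset.mem_insert]
      constructor
      · rintro ⟨hxA, rfl | hxJ⟩
        · exact absurd hxA hvA
        · exact ⟨hxA, hxJ⟩
      · rintro ⟨hxA, hxJ⟩; exact ⟨hxA, Or.inr hxJ⟩
    rw [h1]
    tauto

variable [Fintype ι]

/-- **`T`-joins.** In a scope family of column weight `≤ 2`, let `Kc` be connected and
`u, w ∈ Kc`. Then some set `J` of inner points of `Kc` meets every row `i` an even number of times
iff `i = u ↔ i = w` (i.e. oddly exactly at `u` and `w` when they differ). [folklore] -/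
theorem exists_tjoin (hcw : ∀ v, coverDegree S Finset.univ v ≤ 2) {Kc : Finset ι}
    (hK : IsConn S Kc) {u w : ι} (hu : u ∈ Kc) (hw : w ∈ Kc) :
    ∃ J ⊆ inner S Kc, ∀ i, Even ((S i ∩ J).card) ↔ (i = u ↔ i = w) := by
  classical
  set Reach := Kc.filter fun w' => ∃ J ⊆ inner S Kc, ∀ i, Even ((S i ∩ J).card) ↔ (i = u ↔ i = w')
    with hReach
  suffices hall : Reach = Kc by
    have : w ∈ Reach := hall.symm ▸ hw
    exact (Finset.mem_filter.1 this).2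
  by_contra hne
  have huR : u ∈ Reach := Finset.mem_filter.2 ⟨hu, ∅, Finset.empty_subset _, fun i => by simp⟩
  obtain ⟨j, hjK, hjR, w', hw', v, hv⟩ := hK.step (Finset.filter_subset _ _) ⟨u, huR⟩ hne
  rw [Finset.mem_inter] at hv
  obtain ⟨hw'K, J, hJ, hJpar⟩ := Finset.mem_filter.1 hw'
  have hw'j : w' ≠ j := fun h => hjR (h ▸ hw')
  apply hjR
  refine Finset.mem_filter.2 ⟨hjK, (if v ∈ J then J.erase v else insert v J), ?_, fun i => ?_⟩
  · -- inner points stay inner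
    have hvin : v ∈ inner S Kc := by
      rw [mem_inner, coverDegree]
      have : ({w', j} : Finset ι) ⊆ Kc.filter fun k => v ∈ S k := by
        intro k hk
        rcases Finset.mem_insert.1 hk with rfl | hk
        · exact Finset.mem_filter.2 ⟨hw'K, hv.1⟩
        · rw [Finset.mem_singleton] at hk; subst hk
          exact Finset.mem_filter.2 ⟨hjK, hv.2⟩
      exact le_trans (by rw [Finset.card_pair hw'j]) (Finset.card_le_card this)
    split_ifs
    · exact (Finset.erase_subset _ _).trans hJ
    · exact Finset.insert_subset hvin hJ
  · rw [card_inter_toggle, hJpar i]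
    have hvi : v ∈ S i ↔ (i = w' ∨ i = j) := by
      constructor
      · intro h; exact rows_eq_pair hcw hw'j hv.1 hv.2 h
      · rintro (rfl | rfl); exacts [hv.1, hv.2]
    rw [hvi]
    have key : ∀ a b c : Prop, ¬ (b ∧ c) → (((a ↔ b) ↔ ¬ (b ∨ c)) ↔ (a ↔ c)) := by
      intros; tauto
    exact key _ _ _ fun h => hw'j (h.1.symm.trans h.2)

end Summit.PneNP.PneNP.Theorems.ColumnTwo
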